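import Summits.CriticalPhenomena.PercolationContinuityZ3.Theorems.Transplant.CayleyMilnorKernel
import Summits.CriticalPhenomena.PercolationContinuityZ3.Theorems.Transplant.ExpGrowthCriticalProbLtOne
import HarnessLib

/-!
# Exponential growth is inherited from ANY finite subset's word growth — in particular from subgroups — for EVERY generating set; hence a
# subgroup of exponential growth settles Conj. 4 on every Cayley graph of the ambient group (unconditional)

builds on p205010 (kernel theorem, internal audit signed; external expert review pending) — nothing in this file uses p205010; unconditional, no node
(Hutchcroft's theorem is the PROVED tree theorem `Hutchcroft2016_noPercolationAtCriticality_holds`).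
Lane `prim-bschramm`, seat `prim-bschramm-p4` gen 23 (PART C3 of `P4-GENERAL.md` §45).  Helper file (`--supports stmt-CriticalPhenomena-4575 --as helper`).

THE POINT.  The exponential-growth row of the class map enters concrete groups through certificates: a free pair (`FreePair.hasExponentialGrowth`,
gen 22), a quotient of exponential growth (`WeakCoveringGrowth`, gen 23).  The third robustness — SUBGROUPS, and independence of the generating set —
is this file: for finite `T ⊆ Γ` (not necessarily generating) the graph `Cay(Γ; T)` is the disjoint union of the cosets `g⟨T⟩`, each a copy of
`Cay(⟨T⟩; T)`; **`CayleyGrowth.hasExponentialGrowth_of_subset`: if `Cay(Γ; T)` has exponential growth then so does `Cay(Γ; S)` for EVERY finite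
generating `S`** (each letter of `T` is an `S`-word of length `≤ L`, so `B_T(x, n) ⊆ B_S(x, nL)` — `graphBall_subset`; balls at `x` and at `1` are
isometric by left translation — `ballVolume_eq_one`; repackage `cⁿ ≤ |B_T(1,n)|` (`n ≥ N`) as `2^m ≤ |B_S(x, mR)|` with `c^k ≥ 2`, `R = (k+N)L`, and
conclude with `Milnor.hasExponentialGrowth_of_two_pow_le`).  Consequences: growth type does not depend on the generating set
(`hasExponentialGrowth_iff_of_generating`), and **`criticalContinuity_of_subset_expGrowth` — `θ_g(p_c) = 0` on EVERY Cayley graph of a group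
containing a finitely generated subgroup of exponential growth** (Hutchcroft upstairs), with `p_c < 1` (`conj4_nonvacuous_of_subset_expGrowth`):
e.g. groups containing `F₂`, `BS(1,2)`, a lamplighter, or a free Burnside group of exponential growth (torsion: no free pair to lift).
Def-free (proof lane).
[cite: MilnorSolvableGrowth1968, p. 447 (growth function g_S; independence of S)] [cite: LyonsPeres2016, §7.4 Thm. 7.20] [cite: Hutchcroft2016, Thm. 1]
[cite: BenjaminiSchramm1996, Conj. 4; §2]
-/

noncomputable section

namespace Summit.CriticalPhenomena.PercolationContinuityZ3.Theorems.Transplant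
open SimpleGraph Filter Literature.Probability.LatticeModels Literature.Probability.Percolation
open Literature.Barriers.CriticalPhenomena
open scoped Classical

namespace CayleyGrowth

variable {Γ : Type} [Group Γ] (T S : Finset Γ)

/-- **Every letter of a finite `T` is an `S`-word of bounded length** (`Γ = ⟨S⟩`). [cite: MilnorSolvableGrowth1968, p. 447] -/
theorem exists_letters_radius (hS : Subgroup.closure (S : Set Γ) = ⊤) :
    ∃ L : ℕ, 1 ≤ L ∧ ∀ t ∈ T, t ∈ graphBall (mulCayley (↑S : Set Γ)) 1 L := by
  have h : ∀ t : Γ, ∃ r : ℕ, t ∈ graphBall (mulCayley (↑S : Set Γ)) 1 r := Milnor.exists_mem_graphBall S hS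
  choose r hr using h
  refine ⟨T.sup r + 1, by omega, fun t ht => graphBall_mono _ _ ?_ (hr t)⟩
  have := Finset.le_sup (f := r) ht; omega

/-- **`T`-balls sit inside `S`-balls**: if every letter of `T` has `S`-length `≤ L` then `B_T(1, n) ⊆ B_S(1, nL)`. [cite: MilnorSolvableGrowth1968, p. 447] -/
theorem graphBall_one_subset {L : ℕ} (hL : ∀ t ∈ T, t ∈ graphBall (mulCayley (↑S : Set Γ)) 1 L) (n : ℕ) :
    graphBall (mulCayley (↑T : Set Γ)) 1 n ⊆ graphBall (mulCayley (↑S : Set Γ)) 1 (n * L) := by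
  induction n with
  | zero => intro y hy; rw [graphBall_zero, Set.mem_singleton_iff] at hy; rw [hy, zero_mul]; exact mem_graphBall_self _ _ _
  | succ n ih =>
    intro y hy
    rw [graphBall_succ] at hy
    rcases hy with hy | hy
    · rw [Set.mem_singleton_iff.1 hy]; exact mem_graphBall_self _ _ _
    · rw [Set.mem_iUnion₂] at hy
      obtain ⟨v, hv, hyv⟩ := hy
      -- `v = t^{±1}` is an `S`-word of length `≤ L`
      have hvS : v ∈ graphBall (mulCayley (↑S : Set Γ)) 1 L := by
        rw [mem_neighborSet, mulCayley_adj'] at hv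
        obtain ⟨-, t, ht, h⟩ := hv
        rcases h with h | h
        · rw [one_mul] at h; rw [← h]; exact hL t (Finset.mem_coe.1 ht)
        · have e : v = t⁻¹ := eq_inv_of_mul_eq_one_left h.symm
          rw [e]; exact Milnor.inv_mem_graphBall S (hL t (Finset.mem_coe.1 ht))
      -- `v⁻¹ y ∈ B_T(1, n) ⊆ B_S(1, nL)`
      have hy' : v⁻¹ * y ∈ graphBall (mulCayley (↑T : Set Γ)) 1 n := by
        have h := mem_graphBall_map (leftMulIso T v⁻¹) hyv
        rwa [leftMulIso_apply, leftMulIso_apply, inv_mul_cancel] at h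
      have h := Milnor.mul_mem_graphBall S hvS (ih hy')
      rw [mul_inv_cancel_left] at h
      exact graphBall_mono _ _ (by rw [Nat.succ_mul]; omega) h

/-- **Balls of a Cayley graph are isometric by left translation**: `|B(x, n)| = |B(1, n)|`. [cite: BenjaminiSchramm1996, §2 (Cayley graphs)] -/
theorem ballVolume_eq_one (x : Γ) (n : ℕ) : ballVolume (mulCayley (↑S : Set Γ)) x n = ballVolume (mulCayley (↑S : Set Γ)) 1 n := by
  have hset : graphBall (mulCayley (↑S : Set Γ)) x n = (fun g => x * g) '' graphBall (mulCayley (↑S : Set Γ)) 1 n := by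
    ext y
    constructor
    · intro hy
      refine ⟨x⁻¹ * y, ?_, by show x * (x⁻¹ * y) = y; rw [mul_inv_cancel_left]⟩
      have h := mem_graphBall_map (leftMulIso S x⁻¹) hy
      rwa [leftMulIso_apply, leftMulIso_apply, inv_mul_cancel] at h
    · rintro ⟨g, hg, rfl⟩
      exact Milnor.mul_mem_graphBall_left S x hg
  rw [ballVolume, ballVolume, hset, Set.ncard_image_of_injective _ (mul_right_injective x)]

/-- **THEOREM: exponential growth of `Cay(Γ; T)` for SOME finite `T ⊆ Γ` (e.g. a generating set of a subgroup) forces exponential growth of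
`Cay(Γ; S)` for EVERY finite generating `S`.** [cite: MilnorSolvableGrowth1968, p. 447] [cite: LyonsPeres2016, §7.4] -/
theorem hasExponentialGrowth_of_subset (hS : Subgroup.closure (S : Set Γ) = ⊤) (hT : HasExponentialGrowth (mulCayley (↑T : Set Γ))) :
    HasExponentialGrowth (mulCayley (↑S : Set Γ)) := by
  obtain ⟨L, hL1, hL⟩ := exists_letters_radius T S hS
  obtain ⟨c, hc, hev⟩ := hT 1
  obtain ⟨N, hN⟩ := eventually_atTop.1 hev
  -- `c^k ≥ 2`
  obtain ⟨k, hk⟩ := add_one_pow_unbounded_of_pos (2 : ℝ) (sub_pos.2 hc)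
  rw [sub_add_cancel] at hk
  have hk1 : 1 ≤ k := by
    rcases Nat.eq_zero_or_pos k with h | h
    · rw [h, pow_zero] at hk; norm_num at hk
    · exact h
  have hR : 1 ≤ (k + N) * L := Nat.succ_le_of_lt (Nat.mul_pos (by omega) (by omega))
  refine Milnor.hasExponentialGrowth_of_two_pow_le _ hR fun x m => ?_
  rcases Nat.eq_zero_or_pos m with hm | hm
  · rw [hm, pow_zero]; exact one_le_ballVolume _ _ _
  -- `2^m ≤ c^{mk} ≤ c^{mk+N} ≤ |B_T(1, mk+N)| ≤ |B_S(1, (mk+N)L)| ≤ |B_S(1, m(k+N)L)| = |B_S(x, m(k+N)L)|`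
  have h1 : (2 : ℝ) ^ m ≤ c ^ (m * k + N) := by
    calc (2 : ℝ) ^ m ≤ (c ^ k) ^ m := pow_le_pow_left₀ (by norm_num) hk.le m
      _ = c ^ (m * k) := by rw [← pow_mul, mul_comm]
      _ ≤ c ^ (m * k + N) := pow_le_pow_right₀ hc.le (by omega)
  have h2 : c ^ (m * k + N) ≤ (ballVolume (mulCayley (↑T : Set Γ)) 1 (m * k + N) : ℝ) := hN _ (by omega)
  have h3 : ballVolume (mulCayley (↑T : Set Γ)) 1 (m * k + N) ≤ ballVolume (mulCayley (↑S : Set Γ)) 1 ((m * k + N) * L) :=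
    Set.ncard_le_ncard (graphBall_one_subset T S hL _) (graphBall_finite _ _ _)
  have hle : (m * k + N) * L ≤ m * ((k + N) * L) := by
    have hmN : N ≤ m * N := Nat.le_mul_of_pos_left N hm
    have : m * k + N ≤ m * (k + N) := by rw [mul_add]; omega
    calc (m * k + N) * L ≤ (m * (k + N)) * L := Nat.mul_le_mul_right L this
      _ = m * ((k + N) * L) := by ring
  have h4 : ballVolume (mulCayley (↑S : Set Γ)) 1 ((m * k + N) * L) ≤ ballVolume (mulCayley (↑S : Set Γ)) 1 (m * ((k + N) * L)) :=
    Milnor.ballVolume_mono _ _ hle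
  have h34 : (ballVolume (mulCayley (↑T : Set Γ)) 1 (m * k + N) : ℝ) ≤ (ballVolume (mulCayley (↑S : Set Γ)) 1 (m * ((k + N) * L)) : ℝ) := by
    exact_mod_cast h3.trans h4
  have hreal : (2 : ℝ) ^ m ≤ (ballVolume (mulCayley (↑S : Set Γ)) 1 (m * ((k + N) * L)) : ℝ) := h1.trans (h2.trans h34)
  rw [ballVolume_eq_one S x]
  exact_mod_cast hreal

/-- **Growth type does not depend on the generating set.** [cite: MilnorSolvableGrowth1968, p. 447] -/
theorem hasExponentialGrowth_iff_of_generating (hT : Subgroup.closure (T : Set Γ) = ⊤) (hS : Subgroup.closure (S : Set Γ) = ⊤) :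
    HasExponentialGrowth (mulCayley (↑T : Set Γ)) ↔ HasExponentialGrowth (mulCayley (↑S : Set Γ)) :=
  ⟨hasExponentialGrowth_of_subset T S hS, hasExponentialGrowth_of_subset S T hT⟩

/-- **THEOREM (unconditional): a finite subset of exponential word growth — e.g. a finitely generated subgroup of exponential growth — settles
Conj. 4 on EVERY Cayley graph of the ambient group**: `θ_g(p_c(Cay(Γ; S))) = 0` (Hutchcroft's theorem upstairs). [cite: Hutchcroft2016, Thm. 1]
[cite: BenjaminiSchramm1996, Conj. 4] -/
theorem criticalContinuity_of_subset_expGrowth (hS : Subgroup.closure (S : Set Γ) = ⊤)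
    (hT : HasExponentialGrowth (mulCayley (↑T : Set Γ))) (g : Γ) :
    theta (mulCayley (↑S : Set Γ)) g (criticalProbIOf (mulCayley (↑S : Set Γ)) g) = 0 :=
  Hutchcroft2016_noPercolationAtCriticality_holds _ (CayleyScaled.connected_mulCayley_of_closure S hS)
    (CayleyScaled.isQuasiTransitive_mulCayley S) (hasExponentialGrowth_of_subset T S hS hT) g

/-- **… and non-vacuously: `p_c(Cay(Γ; S), g) < 1 ∧ θ_g(p_c) = 0`.** [cite: BenjaminiSchramm1996, Conj. 4; §2 Conj. 1] [cite: Hutchcroft2016, Thm. 1, Thm. 2] -/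
theorem conj4_nonvacuous_of_subset_expGrowth (hS : Subgroup.closure (S : Set Γ) = ⊤)
    (hT : HasExponentialGrowth (mulCayley (↑T : Set Γ))) (g : Γ) :
    criticalProb (mulCayley (↑S : Set Γ)) g < 1 ∧ theta (mulCayley (↑S : Set Γ)) g (criticalProbIOf (mulCayley (↑S : Set Γ)) g) = 0 :=
  ExpGrowth.conj4_nonvacuous_exponentialGrowth _ (CayleyScaled.connected_mulCayley_of_closure S hS)
    (CayleyScaled.isQuasiTransitive_mulCayley S) (hasExponentialGrowth_of_subset T S hS hT) g

end CayleyGrowth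

end Summit.CriticalPhenomena.PercolationContinuityZ3.Theorems.Transplant
end
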